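import Literature.Computability.Cryptography.LWEGuessTestLayout
import Literature.Computability.Cryptography.LWESwitchRowProgLaw
import HarnessLib

/-!
# The h₃ machine's rate-guess test, IV: on uniform coins the answer bits and the verdict have the law of the estimate-and-flag test

Topic `Computability/Cryptography` (LWE), grouping namespace `BLPRS2013.KProg`; sequel of `LWEGuessTestLayout.lean` (`blockOf_ofFn`, `bitsOf`,
`tVerdictOf_ofFn`) and `LWESwitchRowProgLaw.lean` (`uniformVector_map_rowFlat`, `uniformVector_map_refFlat`). The machine answers query `j` by the
decision `dec u_j c_j` of the subroutine on the code `u_j` of the `j`-th block of switched (or reference) samples and on coins `c_j` cut out of the SAME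
slice of its coin string, `ℓ(u_j)` of them; the slices of distinct queries are disjoint. This file proves, for the CLOSED FORMS (`tQueryFlat`), that on a
uniform coin string the family of answer bits is the independent family the law-level test `LWERateGuessTest.guessTest` draws — rows
`w < G`, batches `i < N_b` with the row kernel `machRowPMF` of guess `w`, reference runs with `m` residue samples — and hence that the verdict has the law
of `flatGuessTest` (everything PROVED; definitions with bodies `decKernel`, `decOn`, `rowSliceBit`, `refSliceBit`, `answerBit`, `answerLaw`; no named
fact; the identification of the record programs `tQuery`/`tVerdictOf` of `LWEGuessTestQuery.lean` with these closed forms is the business of the sequel):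

* `uniformVector_map_take` (a prefix of a uniform string is uniform), `indepLaw_map_bitsOf` (re-indexing `⨂_{j<G·N_b+N'}` into rows and reference);
* `decKernel dec ℓ y` (the subroutine's decision law on a block `y`: uniform coins of length `ℓ(code y)`), `decOn`, `rowSliceBit`, `refSliceBit` (the answer
  bit of one slice), `uniformVector_map_split_decOn`, **`uniformVector_map_rowSliceBit`** (`= machRowPMF ≫= decKernel`), **`uniformVector_map_refSliceBit`**
  (`= (refLaw)^{⊗m} ≫= decKernel`);
* `answerBit`/`answerLaw` (query `j`: row `j / N_b`, batch `j % N_b`, or reference), **`uniformVector_map_answerBits`** (all slices: the independent family),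
  `indepLaw_answerLaw_map_bitsOf` (re-indexed: `guessBits ⊗ refBits`), **`uniformVector_map_verdict`** (the verdict's law is
  `flatGuessTest (decKernel dec ℓ) N_b m (w ↦ machRowPMF … (κ_w) …) ((refLaw)^{⊗m}) N' (1/T)` on the input tuple).

## References

* Z. Brakerski, A. Langlois, C. Peikert, O. Regev, D. Stehlé, *Classical hardness of learning with errors*, STOC 2013; arXiv:1306.0281,
  Lemma 2.15 (proof sketch) with Cor. 3.2 and §5. [BrakerskiEtAl2013]
* S. Arora, B. Barak, *Computational Complexity: A Modern Approach*, CUP 2009, Def. 7.1 (one uniform tape), §3.4 (subroutines). [AroraBarak2009]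
* O. Goldreich, *Foundations of Cryptography I*, CUP 2001, §3.2.3 (independent samples). [Goldreich2001]
-/

noncomputable section

open scoped ENNReal
open PMF Literature.Probability.Distributions Literature.Algebra.EuclideanLattices Literature.Computability.Complexity

namespace Literature.Computability.Cryptography

namespace BLPRS2013

namespace KProg

open GaussRejMachine LWE LWE.MP12 LWE.MP12.Prog

/-! ### Two generic laws -/

/-- **A prefix of a uniform string is uniform**: `(U {0,1}^C).map (f ∘ take k) = (U {0,1}^k).map f` for `k ≤ C`. [cite: AroraBarak2009, Def. 7.1] -/
theorem uniformVector_map_take {β : Type} {k C : ℕ} (hk : k ≤ C) (f : List Bool → β) :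
    (uniformOfFintype (List.Vector Bool C)).map (fun v => f (v.toList.take k)) =
      (uniformOfFintype (List.Vector Bool k)).map (fun u => f u.toList) := by
  classical
  have hfac : (fun v : List.Vector Bool C => f (v.toList.take k)) =
      (fun pr : List.Vector Bool k × List.Vector Bool (C - k) => f pr.1.toList) ∘ vecSplit k C hk := by
    funext v; rfl
  rw [hfac, ← PMF.map_comp, uniformVector_map_vecSplit, uniformOfFintype_prod_eq_bind, PMF.map_bind]
  have : ∀ u : List.Vector Bool k,
      ((uniformOfFintype (List.Vector Bool (C - k))).map (Prod.mk u)).map (fun pr : List.Vector Bool k × List.Vector Bool (C - k) => f pr.1.toList) =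
        PMF.pure (f u.toList) := fun u => by
    rw [PMF.map_comp]
    exact PMF.map_const _ (f u.toList)
  simp_rw [this]
  rw [show (fun u : List.Vector Bool k => PMF.pure (f u.toList)) = PMF.pure ∘ (fun u : List.Vector Bool k => f u.toList) from rfl, PMF.bind_pure_comp]

/-- **Re-indexing the independent family of answer bits into rows and reference**:
`(⨂_{j<G·N_b+N'} f j).map bitsOf = (⨂_w ⨂_i f(w·N_b + i)) ⊗ (⨂_i f(G·N_b + i))`. [cite: Goldreich2001, §3.2.3] -/
theorem indepLaw_map_bitsOf {G Nb N' : ℕ} (f : Fin (G * Nb + N') → PMF Bool) :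
    (indepLaw (G * Nb + N') f).map bitsOf =
      prodLaw (piLaw fun w : Fin G => indepLaw Nb fun i : Fin Nb => f (rowIdx w i)) (indepLaw N' fun i : Fin N' => f (refIdx i)) := by
  classical
  -- the index map `(w, i) ↦ w·N_b + i`, `i' ↦ G·N_b + i'` is injective
  let e : (Fin G × Fin Nb) ⊕ Fin N' → Fin (G * Nb + N') := Sum.elim (fun p => rowIdx p.1 p.2) refIdx
  have he : Function.Injective e := by
    rintro (⟨w, i⟩ | i) (⟨w', i'⟩ | i') h
    · -- both rows: `w N + i = w' N + i'`
      have h' : (w : ℕ) * Nb + i = w' * Nb + i' := by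
        have := congrArg Fin.val h; simpa [e, rowIdx, refIdx] using this
      have hw : (w : ℕ) = w' := by
        have := Nat.lt_of_mul_lt_mul_right (a := Nb) (by nlinarith [i.2, i'.2] : (w : ℕ) * Nb < (w' + 1) * Nb)
        have := Nat.lt_of_mul_lt_mul_right (a := Nb) (by nlinarith [i.2, i'.2] : (w' : ℕ) * Nb < (w + 1) * Nb)
        omega
      have hw' : w = w' := Fin.ext hw
      subst hw'
      have hi : i = i' := Fin.ext (by omega)
      subst hi
      rfl
    · exfalso
      have h' : (w : ℕ) * Nb + i = G * Nb + i' := by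
        have := congrArg Fin.val h; simpa [e, rowIdx, refIdx] using this
      have : (w : ℕ) * Nb + i < G * Nb := by nlinarith [w.2, i.2]
      omega
    · exfalso
      have h' : G * Nb + i = (w' : ℕ) * Nb + i' := by
        have := congrArg Fin.val h; simpa [e, rowIdx, refIdx] using this
      have : (w' : ℕ) * Nb + i' < G * Nb := by nlinarith [w'.2, i'.2]
      omega
    · have h' : G * Nb + (i : ℕ) = G * Nb + i' := by
        have := congrArg Fin.val h; simpa [e, rowIdx, refIdx] using this
      have hi : i = i' := Fin.ext (by omega)
      subst hi
      rfl
  have hbits : (bitsOf : (Fin (G * Nb + N') → Bool) → (Fin G → Fin Nb → Bool) × (Fin N' → Bool)) =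
      (fun pr : (Fin G × Fin Nb → Bool) × (Fin N' → Bool) => ((fun w i => pr.1 (w, i)), pr.2)) ∘
        (fun g : (Fin G × Fin Nb) ⊕ Fin N' → Bool => ((fun a => g (Sum.inl a)), (fun b => g (Sum.inr b)))) ∘
          (fun b x => b ((⟨e, he⟩ : (Fin G × Fin Nb) ⊕ Fin N' ↪ Fin (G * Nb + N')) x)) := by
    funext b; rfl
  rw [indepLaw_eq_piLaw, hbits, ← PMF.map_comp, ← PMF.map_comp, piLaw_map_restrict ⟨e, he⟩, piLaw_map_sumSplit]
  simp only [Function.Embedding.coeFn_mk, e, Sum.elim_inl, Sum.elim_inr]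
  -- curry the first factor, identity on the second
  rw [prodLaw, PMF.map_bind]
  simp only [PMF.map_comp]
  have hc := piLaw_map_curry (fun p : Fin G × Fin Nb => f (rowIdx p.1 p.2))
  have hX : (piLaw fun w : Fin G => indepLaw Nb fun i : Fin Nb => f (rowIdx w i)) =
      (piLaw fun p : Fin G × Fin Nb => f (rowIdx p.1 p.2)).map (fun g w i => g (w, i)) := by
    rw [hc]
    congr 1
    funext w
    rw [indepLaw_eq_piLaw]
  rw [prodLaw, hX, PMF.bind_map, indepLaw_eq_piLaw]
  congr 1


/-! ### The closed-form query, the decision law, and one slice -/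

section Slices

variable {n Q q' : ℕ} [NeZero Q] [NeZero q'] (θ : ℚ) (s N Pr w R : ℕ) (b P : ℕ) (PG : PGParams) (L : ℕ) {m : ℕ}
  (Wk Wr Wkr W : ℕ) (dec : List Bool → List Bool → Bool) (ℓ : List Bool → ℕ)

/-- **The subroutine's decision law on a block**: uniform coins of length `ℓ(code)`, then `dec`. [cite: AroraBarak2009, Def. 7.1 with §3.4] -/
def decKernel (y : Fin m → (Fin n → ZMod q') × ZMod q') : PMF Bool :=
  (uniformOfFintype (List.Vector Bool (ℓ (ldataE (toLData y))))).map fun c => dec (ldataE (toLData y)) c.toList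

/-- The decision on a list-level input `u` with coins cut out of the tail `tl` of a slice. [folklore] -/
def decOn (u : LData) (tl : List Bool) : Bool := dec (ldataE u) (tl.take (ℓ (ldataE u)))

/-- **The answer bit of a ROW slice**: switch the block with the first `W_k` coins (guess multiplier `κh`), decide with coins from offset `W_kr`.
[cite: BrakerskiEtAl2013, Lemma 2.15 with Cor. 3.2 and §5] -/
def rowSliceBit (κh : ℚ) (Sb : Fin m → (Fin n → ZMod Q) × ZMod Q) (sl : List Bool) : Bool :=
  decOn dec ℓ (n, (q', rowFlat θ s N Pr w R q' Q κh b P PG L n (List.ofFn fun i => toItem (Sb i)) (sl.take Wk))) (sl.drop Wkr)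

/-- **The answer bit of a REFERENCE slice**: `m` residue samples from the first `W_r` coins, decide with coins from offset `W_kr`.
[cite: BrakerskiEtAl2013, Lemma 2.15 (proof sketch)] -/
def refSliceBit (sl : List Bool) : Bool :=
  decOn dec ℓ (n, (q', refFlat q' L n m (sl.take Wr))) (sl.drop Wkr)

variable {Wk Wr Wkr W}

omit [NeZero q'] in
/-- The tail of a slice carries enough uniform coins for the decision: integrating out gives `decKernel`. [cite: AroraBarak2009, Def. 7.1] -/
theorem uniformVector_map_decOn {C : ℕ} (y : Fin m → (Fin n → ZMod q') × ZMod q') (hℓ : ℓ (ldataE (toLData y)) ≤ C) :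
    (uniformOfFintype (List.Vector Bool C)).map (fun t => decOn dec ℓ (toLData y) t.toList) = decKernel dec ℓ y := by
  unfold decOn decKernel
  exact uniformVector_map_take hℓ _

omit [NeZero q'] in
/-- Splitting a slice at `W_kr`: a function of `(prefix-determined input, tail)` integrates to `law of the input ≫= decision law`. [folklore] -/
theorem uniformVector_map_split_decOn (hW : Wkr ≤ W) (u : List Bool → LData) (k : ℕ) (hk : k ≤ Wkr)
    (Plaw : PMF (Fin m → (Fin n → ZMod q') × ZMod q'))
    (hu : (uniformOfFintype (List.Vector Bool k)).map (fun v => u v.toList) = Plaw.map toLData)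
    (hℓ : ∀ y : Fin m → (Fin n → ZMod q') × ZMod q', ℓ (ldataE (toLData y)) ≤ W - Wkr) :
    (uniformOfFintype (List.Vector Bool W)).map (fun sl => decOn dec ℓ (u (sl.toList.take k)) (sl.toList.drop Wkr)) =
      Plaw.bind (decKernel dec ℓ) := by
  classical
  have hfac : (fun sl : List.Vector Bool W => decOn dec ℓ (u (sl.toList.take k)) (sl.toList.drop Wkr)) =
      (fun pr : List.Vector Bool Wkr × List.Vector Bool (W - Wkr) => decOn dec ℓ (u (pr.1.toList.take k)) pr.2.toList) ∘ vecSplit Wkr W hW := by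
    funext sl
    simp only [Function.comp_apply, vecSplit, Equiv.coe_fn_mk, List.Vector.toList_mk]
    rw [List.take_take, min_eq_left hk]
  rw [hfac, ← PMF.map_comp, uniformVector_map_vecSplit, uniformOfFintype_prod_eq_bind, PMF.map_bind]
  simp only [PMF.map_comp, Function.comp_def]
  -- the input from the prefix
  have hu' : (uniformOfFintype (List.Vector Bool Wkr)).map (fun v => u (v.toList.take k)) = Plaw.map toLData := by
    rw [uniformVector_map_take hk]; exact hu
  calc ((uniformOfFintype (List.Vector Bool Wkr)).bind fun v₁ =>
        (uniformOfFintype (List.Vector Bool (W - Wkr))).map fun v₂ => decOn dec ℓ (u (v₁.toList.take k)) v₂.toList)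
      = ((uniformOfFintype (List.Vector Bool Wkr)).map fun v => u (v.toList.take k)).bind fun U' =>
          (uniformOfFintype (List.Vector Bool (W - Wkr))).map fun v₂ => decOn dec ℓ U' v₂.toList := by
        rw [PMF.bind_map]; rfl
    _ = (Plaw.map toLData).bind fun U' => (uniformOfFintype (List.Vector Bool (W - Wkr))).map fun v₂ => decOn dec ℓ U' v₂.toList := by rw [hu']
    _ = Plaw.bind fun y => (uniformOfFintype (List.Vector Bool (W - Wkr))).map fun v₂ => decOn dec ℓ (toLData y) v₂.toList := by
        rw [PMF.bind_map]; rfl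
    _ = Plaw.bind (decKernel dec ℓ) := by
        congr 1
        funext y
        exact uniformVector_map_decOn dec ℓ y (hℓ y)

/-- **Law of a row slice's answer bit**: `machRowPMF ≫= decKernel`. [cite: BrakerskiEtAl2013, Lemma 2.15 with Cor. 3.2 and §5; AroraBarak2009, Def. 7.1] -/
theorem uniformVector_map_rowSliceBit (hWk : Wk = n * L + m * sampleWidth n Pr w R P PG) (hk : Wk ≤ Wkr) (hW : Wkr ≤ W)
    (hℓ : ∀ y : Fin m → (Fin n → ZMod q') × ZMod q', ℓ (ldataE (toLData y)) ≤ W - Wkr)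
    (κh : ℚ) (Sb : Fin m → (Fin n → ZMod Q) × ZMod Q) :
    (uniformOfFintype (List.Vector Bool W)).map (fun sl => rowSliceBit (q' := q') θ s N Pr w R b P PG L Wk Wkr dec ℓ κh Sb sl.toList) =
      (machRowPMF n Q q' θ s N Pr w R κh b P PG.lawPMF (2 ^ L) m Sb).bind (decKernel dec ℓ) := by
  refine uniformVector_map_split_decOn dec ℓ hW (fun l => (n, (q', rowFlat θ s N Pr w R q' Q κh b P PG L n (List.ofFn fun i => toItem (Sb i)) l)))
    Wk hk _ ?_ hℓ
  rw [show (fun v : List.Vector Bool Wk => ((n, (q', rowFlat θ s N Pr w R q' Q κh b P PG L n (List.ofFn fun i => toItem (Sb i)) v.toList)) : LData)) =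
      (fun its : List LItem => ((n, (q', its)) : LData)) ∘ (fun v : List.Vector Bool Wk =>
        rowFlat θ s N Pr w R q' Q κh b P PG L n (List.ofFn fun i => toItem (Sb i)) v.toList) from rfl,
    ← PMF.map_comp, uniformVector_map_rowFlat θ s N Pr w R κh b P PG L Sb (le_of_eq hWk.symm), PMF.map_comp]
  try rfl

/-- **Law of a reference slice's answer bit**: `(m residue samples) ≫= decKernel`. [cite: BrakerskiEtAl2013, Lemma 2.15 (proof sketch); AroraBarak2009, Def. 7.1] -/
theorem uniformVector_map_refSliceBit (hWr : Wr = m * ((n + 1) * L)) (hk : Wr ≤ Wkr) (hW : Wkr ≤ W)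
    (hℓ : ∀ y : Fin m → (Fin n → ZMod q') × ZMod q', ℓ (ldataE (toLData y)) ≤ W - Wkr) :
    (uniformOfFintype (List.Vector Bool W)).map (fun sl => refSliceBit (n := n) (q' := q') L (m := m) Wr Wkr dec ℓ sl.toList) =
      (iidPMF (refLaw q' L n) m).bind (decKernel dec ℓ) := by
  refine uniformVector_map_split_decOn dec ℓ hW (fun l => (n, (q', refFlat q' L n m l))) Wr hk _ ?_ hℓ
  rw [show (fun v : List.Vector Bool Wr => ((n, (q', refFlat q' L n m v.toList)) : LData)) =
      (fun its : List LItem => ((n, (q', its)) : LData)) ∘ (fun v : List.Vector Bool Wr => refFlat q' L n m v.toList) from rfl,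
    ← PMF.map_comp, uniformVector_map_refFlat (q := q') (L := L) (n := n) m (le_of_eq hWr.symm), PMF.map_comp]
  try rfl

end Slices

/-! ### All slices: the answer family and the verdict -/

section Family

variable {n Q q' : ℕ} [NeZero Q] [NeZero q'] (θ : ℚ) (s N Pr w R : ℕ) (b P : ℕ) (PG : PGParams) (L : ℕ) {m : ℕ}
  (Wk Wr Wkr W : ℕ) (dec : List Bool → List Bool → Bool) (ℓ : List Bool → ℕ) {G : ℕ} (Nb N' : ℕ) (κw : ℕ → ℚ)

/-- **The answer bit of query `j`** on its slice: a row slice for `j < G·N_b` (row `j / N_b`, batch `j % N_b`), a reference slice otherwise.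
[cite: BrakerskiEtAl2013, Lemma 2.15 (proof sketch)] -/
def answerBit (S : Fin (G * (Nb * m)) → (Fin n → ZMod Q) × ZMod Q) (j : ℕ) (sl : List Bool) : Bool :=
  if h : j < G * Nb then
    have hNb : 0 < Nb := Nat.pos_of_ne_zero fun h0 => by simp [h0] at h
    rowSliceBit (q' := q') θ s N Pr w R b P PG L Wk Wkr dec ℓ (κw (j / Nb))
      (blocksOf Nb m (blocksOf G (Nb * m) S ⟨j / Nb, (Nat.div_lt_iff_lt_mul hNb).2 h⟩) ⟨j % Nb, Nat.mod_lt _ hNb⟩) sl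
  else refSliceBit (n := n) (q' := q') L (m := m) Wr Wkr dec ℓ sl

/-- The law of the answer bit of query `j`. [folklore] -/
def answerLaw (S : Fin (G * (Nb * m)) → (Fin n → ZMod Q) × ZMod Q) (j : ℕ) : PMF Bool :=
  if h : j < G * Nb then
    have hNb : 0 < Nb := Nat.pos_of_ne_zero fun h0 => by simp [h0] at h
    (machRowPMF n Q q' θ s N Pr w R (κw (j / Nb)) b P PG.lawPMF (2 ^ L) m
      (blocksOf Nb m (blocksOf G (Nb * m) S ⟨j / Nb, (Nat.div_lt_iff_lt_mul hNb).2 h⟩) ⟨j % Nb, Nat.mod_lt _ hNb⟩)).bind (decKernel dec ℓ)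
  else (iidPMF (refLaw q' L n) m).bind (decKernel dec ℓ)

variable {Wk Wr Wkr W Nb N'}

/-- **On uniform coins the answer bits are independent with laws `answerLaw`** (`J` slices of width `W`).
[cite: BrakerskiEtAl2013, Lemma 2.15 (proof sketch); Goldreich2001, §3.2.3; AroraBarak2009, Def. 7.1] -/
theorem uniformVector_map_answerBits (hWk : Wk = n * L + m * sampleWidth n Pr w R P PG) (hWr : Wr = m * ((n + 1) * L))
    (hk : Wk ≤ Wkr) (hr : Wr ≤ Wkr) (hW : Wkr ≤ W) (hℓ : ∀ y : Fin m → (Fin n → ZMod q') × ZMod q', ℓ (ldataE (toLData y)) ≤ W - Wkr)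
    (S : Fin (G * (Nb * m)) → (Fin n → ZMod Q) × ZMod Q) {J C : ℕ} (hC : W * J ≤ C) :
    (uniformOfFintype (List.Vector Bool C)).map (fun v => fun j : Fin J =>
      answerBit (q' := q') θ s N Pr w R b P PG L Wk Wr Wkr dec ℓ Nb κw S j (chunks W J hC v j).toList) =
      indepLaw J fun j => answerLaw (q' := q') θ s N Pr w R b P PG L dec ℓ Nb κw S j := by
  rw [show (fun v : List.Vector Bool C => fun j : Fin J => answerBit (q' := q') θ s N Pr w R b P PG L Wk Wr Wkr dec ℓ Nb κw S j (chunks W J hC v j).toList) =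
      (fun c (j : Fin J) => answerBit (q' := q') θ s N Pr w R b P PG L Wk Wr Wkr dec ℓ Nb κw S j (c j).toList) ∘ chunks W J hC from rfl,
    ← PMF.map_comp, uniformVector_map_chunks_eq_indepLaw,
    indepLaw_map_pi J _ (fun (j : Fin J) (sl : List.Vector Bool W) => answerBit (q' := q') θ s N Pr w R b P PG L Wk Wr Wkr dec ℓ Nb κw S j sl.toList)]
  congr 1
  funext j
  unfold answerBit answerLaw
  by_cases h : (j : ℕ) < G * Nb
  · simp only [h, ↓reduceDIte]
    exact uniformVector_map_rowSliceBit θ s N Pr w R b P PG L dec ℓ hWk hk hW hℓ _ _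
  · simp only [h, ↓reduceDIte]
    exact uniformVector_map_refSliceBit L dec ℓ hWr hr hW hℓ

/-- Row index arithmetic: `(w·N_b + i) / N_b = w`, `% N_b = i`. [folklore] -/
theorem rowIdx_div_mod {G Nb N' : ℕ} (w' : Fin G) (i : Fin Nb) :
    ((rowIdx (N' := N') w' i : ℕ) / Nb) = w' ∧ ((rowIdx (N' := N') w' i : ℕ) % Nb) = i := by
  have hNb : 0 < Nb := Nat.pos_of_ne_zero fun h0 => by have := i.2; omega
  rw [val_rowIdx]
  constructor
  · rw [Nat.add_comm, Nat.add_mul_div_right _ _ hNb, Nat.div_eq_of_lt i.2, Nat.zero_add]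
  · rw [Nat.add_comm, Nat.add_mul_mod_self_right, Nat.mod_eq_of_lt i.2]

omit [NeZero Q] in
/-- **The answer family, re-indexed, has the law the law-level test draws**: rows `guessBits`, reference `refBits`.
[cite: BrakerskiEtAl2013, Lemma 2.15 (proof sketch)] -/
theorem indepLaw_answerLaw_map_bitsOf (S : Fin (G * (Nb * m)) → (Fin n → ZMod Q) × ZMod Q) :
    (indepLaw (G * Nb + N') fun j => answerLaw (q' := q') θ s N Pr w R b P PG L dec ℓ Nb κw S j).map bitsOf =
      prodLaw (guessBits (decKernel dec ℓ) (fun (w' : Fin G) (Sb : Fin m → (Fin n → ZMod Q) × ZMod Q) =>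
          machRowPMF n Q q' θ s N Pr w R (κw w') b P PG.lawPMF (2 ^ L) m Sb) Nb (fun w' => blocksOf Nb m (blocksOf G (Nb * m) S w')))
        (refBits (decKernel dec ℓ) (iidPMF (refLaw q' L n) m) N') := by
  rw [indepLaw_map_bitsOf]
  have hrow : ∀ (w' : Fin G) (i : Fin Nb), answerLaw (q' := q') θ s N Pr w R b P PG L dec ℓ Nb κw S (rowIdx (N' := N') w' i) =
      (machRowPMF n Q q' θ s N Pr w R (κw w') b P PG.lawPMF (2 ^ L) m (blocksOf Nb m (blocksOf G (Nb * m) S w') i)).bind (decKernel dec ℓ) := by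
    intro w' i
    have h := rowIdx_div_mod (N' := N') w' i
    have hlt : (rowIdx (N' := N') w' i : ℕ) < G * Nb := by rw [val_rowIdx]; nlinarith [w'.2, i.2]
    have key : ∀ (a : ℕ) (ha : a < G) (c : ℕ) (hc : c < Nb), a = w' → c = i →
        (machRowPMF n Q q' θ s N Pr w R (κw a) b P PG.lawPMF (2 ^ L) m (blocksOf Nb m (blocksOf G (Nb * m) S ⟨a, ha⟩) ⟨c, hc⟩)).bind
          (decKernel dec ℓ) =
        (machRowPMF n Q q' θ s N Pr w R (κw w') b P PG.lawPMF (2 ^ L) m (blocksOf Nb m (blocksOf G (Nb * m) S w') i)).bind (decKernel dec ℓ) := by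
      rintro a ha c hc rfl rfl; rfl
    unfold answerLaw
    rw [dif_pos hlt]
    exact key _ _ _ _ h.1 h.2
  have href : ∀ i : Fin N', answerLaw (q' := q') θ s N Pr w R b P PG L dec ℓ Nb κw S (refIdx (G := G) (N := Nb) i) =
      (iidPMF (refLaw q' L n) m).bind (decKernel dec ℓ) := by
    intro i
    have hge : ¬ ((refIdx (G := G) (N := Nb) i : ℕ) < G * Nb) := by rw [val_refIdx]; omega
    unfold answerLaw
    rw [dif_neg hge]
  simp only [hrow, href]
  unfold guessBits rowBits refBits
  rw [ansLaw_eq_iidPMF, ← indepLaw_const ((iidPMF (refLaw q' L n) m).bind (decKernel dec ℓ)) N']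

open Classical in
/-- **On uniform coins the verdict has the law of the flat estimate-and-flag test** (`θ = 1/T`; record fields `G, N_b, N', T`).
[cite: BrakerskiEtAl2013, Lemma 2.15 (proof sketch)] -/
theorem uniformVector_map_verdict (hWk : Wk = n * L + m * sampleWidth n Pr w R P PG) (hWr : Wr = m * ((n + 1) * L))
    (hk : Wk ≤ Wkr) (hr : Wr ≤ Wkr) (hW : Wkr ≤ W) (hℓ : ∀ y : Fin m → (Fin n → ZMod q') × ZMod q', ℓ (ldataE (toLData y)) ≤ W - Wkr)
    (r : TRec) (hG : r.nG = G) (hN : r.nN = Nb) (hN' : r.nN' = N') {T : ℕ} (hT : r.tt = T) (hT0 : 0 < T)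
    (S : Fin (G * (Nb * m)) → (Fin n → ZMod Q) × ZMod Q) {C : ℕ} (hC : W * (G * Nb + N') ≤ C) :
    (uniformOfFintype (List.Vector Bool C)).map (fun v => tVerdictOf r (List.ofFn fun j : Fin (G * Nb + N') =>
      answerBit (q' := q') θ s N Pr w R b P PG L Wk Wr Wkr dec ℓ Nb κw S j (chunks W (G * Nb + N') hC v j).toList)) =
      flatGuessTest (decKernel dec ℓ) Nb m (fun (w' : Fin G) (Sb : Fin m → (Fin n → ZMod Q) × ZMod Q) =>
          machRowPMF n Q q' θ s N Pr w R (κw w') b P PG.lawPMF (2 ^ L) m Sb) (iidPMF (refLaw q' L n) m) N' (1 / (T : ℝ)) S := by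
  have hfac : (fun v : List.Vector Bool C => tVerdictOf r (List.ofFn fun j : Fin (G * Nb + N') =>
      answerBit (q' := q') θ s N Pr w R b P PG L Wk Wr Wkr dec ℓ Nb κw S j (chunks W (G * Nb + N') hC v j).toList)) =
      (fun bb : Fin (G * Nb + N') → Bool => decide (bitsOf bb ∈ gapSet Nb N' (1 / (T : ℝ)))) ∘
        (fun v => fun j : Fin (G * Nb + N') => answerBit (q' := q') θ s N Pr w R b P PG L Wk Wr Wkr dec ℓ Nb κw S j (chunks W (G * Nb + N') hC v j).toList) := by
    funext v
    exact tVerdictOf_ofFn r hG hN hN' hT hT0 _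
  rw [hfac, ← PMF.map_comp, uniformVector_map_answerBits θ s N Pr w R b P PG L dec ℓ κw hWk hWr hk hr hW hℓ S hC,
    show (fun bb : Fin (G * Nb + N') → Bool => decide (bitsOf bb ∈ gapSet Nb N' (1 / (T : ℝ)))) =
      (fun v => decide (v ∈ gapSet Nb N' (1 / (T : ℝ)))) ∘ bitsOf from rfl,
    ← PMF.map_comp, indepLaw_answerLaw_map_bitsOf]
  rfl

end Family

end KProg

end BLPRS2013

end Literature.Computability.Cryptography

end
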